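import Summits.QuantumFields.YangMills.Theorems.BalabanUVNodesPortS1JacKStepBox

/-!
# NODE O port PT-A — ★★★ `JacKStep F` PROVED: THE `k`-STEP READING OF (1.11)–(1.16) AT THE RECORD (the registered stub `stub_LZjacKStep` of the skeleton `pta_residueW` v3), by the box axial
# gauge of the `SU(2)` factor on the two-block tower region (pv26's `T4AxialGaugeSmallField`), the splice by `1` off the region, ★19200-p2's `k`-uniform reads bound through the bridge
# `towerBridge_of_reads`, PTZ-1's gauge covariance, and dag-n12-c's two-block locality — ALL COMPOSED, nothing of Bałaban re-proved

Cell `ym-nodeO-ideate`, porter seat `ymgap-nodeO-port-PTA-1` (gen 6); proof file, `--supports stmt-QuantumFields-27930`.  [I] = [Balaban1987RG1], [B7] = [Balaban1985Averaging], [6] =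
[Balaban1985RegularSpaces].
CONTENTS (theorems only; `M₂(ℂ)` with the `L²`-operator norm).
* §1 GEOMETRY of the tower region `B^{k+1} ⁻¹' {c₋, c₊}` as the image of the non-wrapping two-block box `[L^{k+1}t, L^{k+1}(t + e_{dir}) + (L^{k+1} − 1)]` of the cover (`t` = the val-lift of
  `c₋`): `src_eq_castSite_valLift`, `tgt_eq_castSite_valLift_add_e`, `iterBlockOf_cover_of_mem_twoBox`, `mem_image_twoBox_of_mem_towerRegion`, `twoBox_nonwrapping`
  (`k + 2 ≤ m + K`), `twoBox_side_le`, ★ `bondsIn_towerRegion_subset_boxBonds`, ★ `boxPlaqs_twoBox_subset_plaqInside` (dag-n07-e's `N07IterPlaquettesOfFineBoxPlaquettes` ∕ `N07ShearSizeTopBox`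
  plumbing, composed).
* §2 `norm_mul_mul_adjugate_sub_one_le` (`SU(2)` conjugation), `norm_exp_I_smul_sub_one_le` (`‖e^{iξA} − 1‖ ≤ 2ξ‖A‖`, via `Literature.Analysis.Calculus.norm_exp_sub_one_le`).
* §3 ★★★ `towerLoopSmall_of_towerSmallField` — `TowerSmallField k c ξ α₀ α₁ 𝐕` ((i)(ii)(iii) on the region), `k + 2 ≤ m + K`, `ξα₁ ≤ 1`, budget `6400ℓ²Lᵏs₀ ≤ 1` at
  `s₀ := 2ξα₁ + (d−1)(2L^{k+1}−1)α₀ξ²` ⟹ all tower loops of `Ū^j(𝐕)`, `j ≤ k`, within `120ℓ²Lᵏs₀` of `1` (the `SU(2)` packaging `U′` of `U`, `PlaqSmallOn (plaqInside Y) (α₀ξ²) U′`, the box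
  gauge `axialGauge U′ lo hi` with reads `(d−1)(2L^{k+1}−1)α₀ξ²`, the conjugated exponential, the `det = 1` splice `W`, `towerLoops_of_gauged_splice`).
* §4 ★★★ `jacKStep_holds : JacKStep F` — `Mth := L`, `α₀ = α₁ := min (1∕(51200ℓ²)) (a∕(960ℓ²))`, `ℓ = 6L`; `Lᵏs₀ ≤ 8α∕L` from `L^{k+1}ξ = 1` (the scaled radius makes the bound UNIFORM IN `k`).
After this file the skeleton's stub `stub_LZjacKStep : ∀ F, JacKStep F` is `fun F => jacKStep_holds F` (companion stub file); open on the P0-free side: `stub_LZjacDom` only (PTZ-1's rows, localized).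

HONEST FRAMING.  Bookkeeping∕algebra∕elementary estimates composing landed theorems (★19200-p2 `Prop8Chart.norm_emlIterU_sub_one_le_of_reads` — [B7] Prop. 4-type factorisation, kernel-checked
there; pv26's torus non-abelian Poincaré lemma; dag-n07-e's box plumbing; PTZ-1's `avgMh_gauge` ∕ `det_avgMh_eq_one`; dag-n12-c's locality); NOTHING of Bałaban's renormalization-group
estimates asserted or re-proved; `stub_LZjacDom` OPEN · `stub_LZdet` BLOCKED-ON P0 (α)+(β) · `stub_FE` XXL; 27930 OPEN · no claim; K0⁷∕K-Ax OPEN; NODE O 0∕1; COUNT 8∕28 · K 1∕4 UNMOVED; finite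
`𝕋⁴_{L^K}` at fixed ε — NOT continuum ∕ OS ∕ Clay; **the Yang–Mills mass gap is NOT proved by any of this.**  No `sorry`, no `def`, no `instance`, no `notation`; standard axioms.
-/

noncomputable section

open scoped BigOperators Matrix.Norms.L2Operator Topology

namespace Summit.QuantumFields.YangMills.Theorems.BalabanUVNodesPortS1

open Summit.QuantumFields.YangMills.Theorems.K0RecordFormatNames
open Literature.MathematicalPhysics.QuantumFieldTheory.Balaban1983to89
open Literature.MathematicalPhysics.QuantumFieldTheory.Balaban1983to89.Node00
open Literature.MathematicalPhysics.QuantumFieldTheory.Balaban1983to89.T4Continuum (T4Family)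
open Literature.MathematicalPhysics.QuantumFieldTheory.Balaban1983to89.B10Eq42TorusConstraint (bondsIn mem_bondsIn_iff)
open Literature.MathematicalPhysics.QuantumFieldTheory.Balaban1983to89.T4AxialGaugeSmallField (castSite castSite_apply castSite_add_e boxBonds boxPlaqs)
open Literature.MathematicalPhysics.QuantumFieldTheory.Balaban1983to89.B5Eq118OneStroke (iterBlockOf iterBlockOf_succ iterBlockOf_zero iterBlock mem_iterBlock)
open Literature.MathematicalPhysics.QuantumFieldTheory.Balaban1983to89.B7Prop1Explicit (e e_apply)
open Literature.MathematicalPhysics.QuantumFieldTheory.Balaban1983to89.B14DomainGeom (Pt)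
open Literature.MathematicalPhysics.QuantumFieldTheory.Balaban1983to89.B15Eq112TorusCover (cover)
open Literature.MathematicalPhysics.QuantumLattice (blockMap blockSites mem_blockSites_iff)
open Summit.QuantumFields.YangMills.BalabanUVNodes.N07IterPlaquettesOfFineBoxPlaquettes (mem_fineBox_of_iterBlockOf_eq)
open Summit.QuantumFields.YangMills.BalabanUVNodes.N07ShearSizeTopBox (mem_boxBonds_of_ends_mem_box)
open Literature.MathematicalPhysics.QuantumFieldTheory.Balaban1983to89.BlockAveraging (Idx)
open Literature.MathematicalPhysics.QuantumFieldTheory.Balaban1983to89.B15AveragingHolomorphic (loopMh iterMh)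
open _root_.Matrix

variable {P : Params}

/-! ## §3  ★★★ Tower loop-smallness from `TowerSmallField`: the box gauge of the `SU(2)` factor, the splice, and `towerLoops_of_gauged_splice` -/

/-- ★★★ **TOWER LOOP-SMALLNESS FROM (i)(ii)(iii) ON THE TOWER REGION.**  Let `k + 2 ≤ m + K`, `c` a level-`(k+1)` bond, `ξ = eta (k+1)`, `0 ≤ α₀`, `0 ≤ α₁`, `ξα₁ ≤ 1`, and `𝐕` a
field with `TowerSmallField k c ξ α₀ α₁ 𝐕` (`𝐕 = e^{iξA}U` on the region, `U ∈ SU(2)`, `‖∂U − 1‖ < α₀ξ²` inside the region, `‖A‖ < α₁`).  Put `s₀ := 2ξα₁ + (d−1)(2L^{k+1}−1)·α₀ξ²`.  If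
`6400ℓ²Lᵏs₀ ≤ 1` then every (0.4) loop of `Ū^j(𝐕)`, `j ≤ k`, at the region's level-`(j+1)` bonds is within `120ℓ²Lᵏs₀` of `1`.  (The axial gauge of `U` on the non-wrapping two-block box
under `c` — pv26's `T4AxialGaugeSmallField` — makes `U` bondwise `(d−1)(2L^{k+1}−1)α₀ξ²`-close to `1` there; conjugating `e^{iξA}` by it costs nothing; splice by `1` off the region; then
`towerLoops_of_gauged_splice`.) [cite: Balaban1987RG1, p.263 L8–10, (1.11)–(1.13) p.262, (0.4) p.253; Balaban1985Averaging, Prop. 2 (54) p.26; Balaban1985RegularSpaces, Lemma 1 p.79] -/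
theorem towerLoopSmall_of_towerSmallField {k : ℕ} (hk2 : k + 2 ≤ P.m + P.K) (c : PBond P (k + 1)) {α₀ α₁ : ℝ} (hα₀ : 0 ≤ α₀) (hα₁ : 0 ≤ α₁)
    (hξα : P.eta (k + 1) * α₁ ≤ 1) (V : PBond P 0 → MatA 2) (hT : TowerSmallField k c (P.eta (k + 1)) α₀ α₁ V)
    (hbudget : 6400 * (((P.d + 2) * P.L : ℕ) : ℝ) ^ 2 * (P.L : ℝ) ^ k *
      (2 * (P.eta (k + 1) * α₁) + ((P.d - 1 : ℕ) : ℝ) * ((2 * P.L ^ (k + 1) - 1 : ℕ) : ℝ) * (α₀ * P.eta (k + 1) ^ 2)) ≤ 1) :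
    ∀ j : ℕ, j ≤ k → ∀ c' : PBond P (j + 1), c' ∈ bondsIn (j + 1) (B14.Eq22Determines.blockIter (k + 1) ⁻¹' ({c.src, c.tgt} : Set (Site P (k + 1)))) →
      ∀ i : Idx P, ‖loopMh (iterMh j V) c' i - 1‖ ≤ 120 * (((P.d + 2) * P.L : ℕ) : ℝ) ^ 2 * (P.L : ℝ) ^ k *
        (2 * (P.eta (k + 1) * α₁) + ((P.d - 1 : ℕ) : ℝ) * ((2 * P.L ^ (k + 1) - 1 : ℕ) : ℝ) * (α₀ * P.eta (k + 1) ^ 2)) := by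
  classical
  have hk1 : k + 1 ≤ P.m + P.K := by omega
  set ξ : ℝ := P.eta (k + 1) with hξ
  have hξ0 : 0 ≤ ξ := by rw [hξ, Params.eta]; positivity
  set Y : Set (Site P 0) := B14.Eq22Determines.blockIter (k + 1) ⁻¹' ({c.src, c.tgt} : Set (Site P (k + 1))) with hY
  set t : Pt P.d := fun κ => ((c.src κ).val : ℤ) with ht
  set lo : Pt P.d := fun i => (P.L : ℤ) ^ (k + 1) * t i with hlo
  set hi : Pt P.d := fun i => (P.L : ℤ) ^ (k + 1) * (t + e c.dir) i + ((P.L : ℤ) ^ (k + 1) - 1) with hhi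
  set sB : ℝ := ((P.d - 1 : ℕ) : ℝ) * ((2 * P.L ^ (k + 1) - 1 : ℕ) : ℝ) * (α₀ * ξ ^ 2) with hsB
  set s₀ : ℝ := 2 * (ξ * α₁) + sB with hs₀
  obtain ⟨U, A, hbond, hplaq, -⟩ := hT
  -- the `SU(2)` packaging of `U`
  set U' : GaugeField P 0 (Matrix.specialUnitaryGroup (Fin 2) ℂ) := fun b =>
    if h : ((U b : (MatA 2)ˣ) : MatA 2) ∈ Matrix.specialUnitaryGroup (Fin 2) ℂ then ⟨_, h⟩ else 1 with hU'
  have hU'eq : ∀ b : PBond P 0, b ∈ bondsIn 0 Y → ((U' b : Matrix.specialUnitaryGroup (Fin 2) ℂ) : MatA 2) = ((U b : (MatA 2)ˣ) : MatA 2) := by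
    intro b hb
    have h := (hbond b hb).2.1
    simp only [hU', dif_pos h]
  -- plaquette smallness of `U'` inside the region
  have hshift : ∀ (x : Site P 0) (μ ν : Fin P.d), (x.shift μ).shift ν = (x.shift ν).shift μ := by
    intro x μ ν
    funext κ
    by_cases h1 : κ = ν
    · subst h1
      by_cases h2 : κ = μ
      · subst h2; rfl
      · simp [Site.shift, Function.update_of_ne h2]
    · by_cases h2 : κ = μ
      · subst h2
        simp [Site.shift, Function.update_of_ne h1]
      · simp [Site.shift, Function.update_of_ne h1, Function.update_of_ne h2]
  have hPlaq : PlaqSmallOn (plaqInside Y) (α₀ * ξ ^ 2) U' := by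
    intro p hp
    obtain ⟨h1, h2, h3, h4⟩ := hp
    have hb1 : (⟨p.src, p.μ⟩ : PBond P 0) ∈ bondsIn 0 Y := mem_bondsIn_iff.2 ⟨h1, h2⟩
    have hb2 : (⟨p.src.shift p.μ, p.ν⟩ : PBond P 0) ∈ bondsIn 0 Y := mem_bondsIn_iff.2 ⟨h2, h4⟩
    have hb3 : (⟨p.src.shift p.ν, p.μ⟩ : PBond P 0) ∈ bondsIn 0 Y := mem_bondsIn_iff.2 ⟨h3, by
      show (p.src.shift p.ν).shift p.μ ∈ Y; rw [← hshift]; exact h4⟩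
    have hb4 : (⟨p.src, p.ν⟩ : PBond P 0) ∈ bondsIn 0 Y := mem_bondsIn_iff.2 ⟨h1, h3⟩
    have hinv : ∀ b : PBond P 0, b ∈ bondsIn 0 Y →
        (((U' b)⁻¹ : Matrix.specialUnitaryGroup (Fin 2) ℂ) : MatA 2) = (((U b)⁻¹ : (MatA 2)ˣ) : MatA 2) := by
      intro b hb
      have hSU := (hbond b hb).2.1
      have hstar : (((U' b)⁻¹ : Matrix.specialUnitaryGroup (Fin 2) ℂ) : MatA 2) = star ((U b : (MatA 2)ˣ) : MatA 2) := by
        rw [← hU'eq b hb]; rfl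
      rw [hstar, Matrix.coe_units_inv]
      exact (Matrix.inv_eq_left_inv (Matrix.mem_unitaryGroup_iff'.1 (Matrix.mem_specialUnitaryGroup_iff.1 hSU).1)).symm
    have hcoe : ((GaugeField.plaqHol U' p : Matrix.specialUnitaryGroup (Fin 2) ℂ) : MatA 2) = ((B12RegularSpaces111.plaq U p : (MatA 2)ˣ) : MatA 2) := by
      rw [B12RegularSpaces111.plaq_eq, GaugeField.plaqHol]
      simp only [Submonoid.coe_mul, Units.val_mul]
      rw [hU'eq _ hb1, hU'eq _ hb2, hinv _ hb3, hinv _ hb4]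
    show ‖((GaugeField.plaqHol U' p : Matrix.specialUnitaryGroup (Fin 2) ℂ) : MatA 2) - 1‖ < α₀ * ξ ^ 2
    rw [hcoe]
    exact (hplaq p ⟨h1, h2, h3, h4⟩).1
  -- the box gauge
  set g := T4AxialGaugeSmallField.axialGauge U' lo hi with hg
  set u : Site P 0 → MatA 2 := fun x => ((g x : Matrix.specialUnitaryGroup (Fin 2) ℂ) : MatA 2) with hu
  have huSU : ∀ x, u x ∈ Matrix.specialUnitaryGroup (Fin 2) ℂ := fun x => (g x).2
  have hudet : ∀ x, (u x).det = 1 := fun x => (Matrix.mem_specialUnitaryGroup_iff.1 (huSU x)).2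
  have huU : ∀ x, u x ∈ Matrix.unitaryGroup (Fin 2) ℂ := fun x => (Matrix.mem_specialUnitaryGroup_iff.1 (huSU x)).1
  have huadj : ∀ x, (u x).adjugate = star (u x) := by
    intro x
    have hga : u x * (u x).adjugate = 1 := by rw [mul_adjugate, hudet, one_smul]
    calc (u x).adjugate = (star (u x) * u x) * (u x).adjugate := by rw [Matrix.mem_unitaryGroup_iff'.1 (huU x), one_mul]
      _ = star (u x) := by rw [mul_assoc, hga, mul_one]
  have hadj_mul : ∀ x, (u x).adjugate * u x = 1 := fun x => by rw [adjugate_mul, hudet, one_smul]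
  -- reads of the `SU(2)` part in the box gauge
  have hn : ∀ κ, hi κ ≤ lo κ + ((2 * P.L ^ (k + 1) - 1 : ℕ) : ℤ) := twoBox_side_le t c.dir
  have hnN : 2 * P.L ^ (k + 1) - 1 < P.sitesPerDir 0 := by
    have hpow : P.L ^ (k + 1) < P.L ^ (P.m + P.K) := Nat.pow_lt_pow_right P.hL.2 (by omega)
    rw [Params.sitesPerDir, Nat.sub_zero]; omega
  have hGread : ∀ b : PBond P 0, b ∈ bondsIn 0 Y → ‖u b.src * ((U b : (MatA 2)ˣ) : MatA 2) * (u b.tgt).adjugate - 1‖ ≤ sB := by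
    intro b hb
    have hbox := bondsIn_towerRegion_subset_boxBonds hk2 c hb
    have h := T4AxialGaugeSmallField.dist1_gaugeAct_axialGauge_le_of_mem_boxBonds U' (boxPlaqs_twoBox_subset_plaqInside hk1 c) hPlaq
      (by positivity) hn hnN hbox
    have hcoe : ((GaugeField.gaugeAct g U' b : Matrix.specialUnitaryGroup (Fin 2) ℂ) : MatA 2) = u b.src * ((U b : (MatA 2)ˣ) : MatA 2) * (u b.tgt).adjugate := by
      rw [GaugeField.gaugeAct, Submonoid.coe_mul, Submonoid.coe_mul, hU'eq b hb, huadj]; rfl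
    have h' : ‖((GaugeField.gaugeAct g U' b : Matrix.specialUnitaryGroup (Fin 2) ℂ) : MatA 2) - 1‖ ≤ sB := h
    rwa [hcoe] at h'
  have hGunit : ∀ b : PBond P 0, b ∈ bondsIn 0 Y → u b.src * ((U b : (MatA 2)ˣ) : MatA 2) * (u b.tgt).adjugate ∈ Matrix.unitaryGroup (Fin 2) ℂ := by
    intro b hb
    have hcoe : ((GaugeField.gaugeAct g U' b : Matrix.specialUnitaryGroup (Fin 2) ℂ) : MatA 2) = u b.src * ((U b : (MatA 2)ˣ) : MatA 2) * (u b.tgt).adjugate := by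
      rw [GaugeField.gaugeAct, Submonoid.coe_mul, Submonoid.coe_mul, hU'eq b hb, huadj]; rfl
    rw [← hcoe]; exact (Matrix.mem_specialUnitaryGroup_iff.1 (GaugeField.gaugeAct g U' b).2).1
  -- the gauged field on the region and its reads
  have hVu : ∀ b : PBond P 0, b ∈ bondsIn 0 Y →
      u b.src * V b * (u b.tgt).adjugate =
        (u b.src * NormedSpace.exp ((Complex.I * (ξ : ℂ)) • A b) * (u b.src).adjugate) * (u b.src * ((U b : (MatA 2)ˣ) : MatA 2) * (u b.tgt).adjugate) := by
    intro b hb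
    rw [(hbond b hb).1, Units.val_mul]
    show u b.src * (NormedSpace.exp ((Complex.I * (ξ : ℂ)) • A b) * ((U b : (MatA 2)ˣ) : MatA 2)) * (u b.tgt).adjugate = _
    calc u b.src * (NormedSpace.exp ((Complex.I * (ξ : ℂ)) • A b) * ((U b : (MatA 2)ˣ) : MatA 2)) * (u b.tgt).adjugate
        = u b.src * NormedSpace.exp ((Complex.I * (ξ : ℂ)) • A b) * ((u b.src).adjugate * u b.src) * ((U b : (MatA 2)ˣ) : MatA 2) * (u b.tgt).adjugate := by
          rw [hadj_mul, mul_one]; noncomm_ring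
      _ = _ := by noncomm_ring
  have hread : ∀ b : PBond P 0, b ∈ bondsIn 0 Y → ‖u b.src * V b * (u b.tgt).adjugate - 1‖ ≤ s₀ := by
    intro b hb
    rw [hVu b hb]
    set E' := u b.src * NormedSpace.exp ((Complex.I * (ξ : ℂ)) • A b) * (u b.src).adjugate
    set G' := u b.src * ((U b : (MatA 2)ˣ) : MatA 2) * (u b.tgt).adjugate
    have hE : ‖E' - 1‖ ≤ 2 * (ξ * α₁) := by
      refine (norm_mul_mul_adjugate_sub_one_le _ (huSU _) _).trans ?_
      have hA : ξ * ‖A b‖ ≤ ξ * α₁ := mul_le_mul_of_nonneg_left (hbond b hb).2.2.2.le hξ0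
      exact (norm_exp_I_smul_sub_one_le hξ0 (A b) (hA.trans hξα)).trans (by linarith)
    have hG1 : ‖G'‖ = 1 := CStarRing.norm_coe_unitary ⟨G', hGunit b hb⟩
    have e1 : E' * G' - 1 = (E' - 1) * G' + (G' - 1) := by noncomm_ring
    calc ‖E' * G' - 1‖ = ‖(E' - 1) * G' + (G' - 1)‖ := by rw [e1]
      _ ≤ ‖E' - 1‖ * ‖G'‖ + ‖G' - 1‖ := (norm_add_le _ _).trans (by gcongr; exact norm_mul_le _ _)
      _ ≤ 2 * (ξ * α₁) * 1 + sB := by rw [hG1]; gcongr; exact hGread b hb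
      _ = s₀ := by rw [hs₀, mul_one]
  -- determinants on the region
  have hdetV : ∀ b : PBond P 0, b ∈ bondsIn 0 Y → (u b.src * V b * (u b.tgt).adjugate).det = 1 := by
    intro b hb
    obtain ⟨hVb, hSU, htr, -⟩ := hbond b hb
    rw [det_mul, det_mul, hudet, one_mul, det_adjugate, hudet, one_pow, mul_one, hVb, Units.val_mul, det_mul]
    show (NormedSpace.exp ((Complex.I * (ξ : ℂ)) • A b)).det * ((U b : (MatA 2)ˣ) : MatA 2).det = 1
    rw [B13Inv214OrbitSUN.det_exp_smul_of_trace_eq_zero htr, (Matrix.mem_specialUnitaryGroup_iff.1 hSU).2, one_mul]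
  -- the splice `W`
  set W : GaugeField P 0 (MatA 2)ˣ := fun b =>
    if hb : b ∈ bondsIn 0 Y then
      ⟨u b.src * V b * (u b.tgt).adjugate, (u b.src * V b * (u b.tgt).adjugate).adjugate,
        by rw [mul_adjugate, hdetV b hb, one_smul], by rw [adjugate_mul, hdetV b hb, one_smul]⟩
    else 1 with hW
  have hWin : ∀ b : PBond P 0, b ∈ bondsIn 0 Y → ((W b : (MatA 2)ˣ) : MatA 2) = u b.src * V b * (u b.tgt).adjugate := by
    intro b hb; simp only [hW, dif_pos hb]
  have hWout : ∀ b : PBond P 0, b ∉ bondsIn 0 Y → ((W b : (MatA 2)ˣ) : MatA 2) = 1 := by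
    intro b hb; simp only [hW, dif_neg hb, Units.val_one]
  have hs₀0 : 0 ≤ s₀ := by positivity
  have hWdet : ∀ b, ((W b : (MatA 2)ˣ) : MatA 2).det = 1 := by
    intro b
    by_cases hb : b ∈ bondsIn 0 Y
    · rw [hWin b hb]; exact hdetV b hb
    · rw [hWout b hb, det_one]
  have hWread : ∀ b, ‖((W b : (MatA 2)ˣ) : MatA 2) - 1‖ ≤ s₀ := by
    intro b
    by_cases hb : b ∈ bondsIn 0 Y
    · rw [hWin b hb]; exact hread b hb
    · rw [hWout b hb, sub_self, norm_zero]; exact hs₀0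
  exact towerLoops_of_gauged_splice hk1 c V u huSU W hWdet hs₀0 hWread hbudget (fun b hb => hWin b hb)


/-! ## §4  ★★★ `JacKStep F` for every torus family — the registered stub `stub_LZjacKStep` -/

section Record

variable (F : T4Family)

/-- ★★★ **THE `k`-STEP READING OF (1.11)–(1.16) AT THE RECORD HOLDS**: for every loop threshold `a > 0`, with `Mth := L` and `α₀ = α₁ := min (1∕(51200ℓ²)) (a∕(960ℓ²))`, `ℓ = 6L`, every pair
of `recordUc F Mc k α₀ α₁ (recordK₀ + n) (X(c))` has a `det = 1` gauge transform that is `TowerLoopSmall k c a` — the reading (`exists_gauge_towerSmallField_of_mem_recordUc`), the box gauge +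
splice + bridge (`towerLoopSmall_of_towerSmallField`), and the arithmetic `Lᵏ·s₀ ≤ 8α∕L` of the scaled radius `ξ = L^{−(k+1)}` (uniform in `k`).
[cite: Balaban1987RG1, p.263 L8–10, (1.11)–(1.16) p.262; Balaban1985Averaging, Prop. 2 (54) p.26, Prop. 4 (134)–(135) p.38] -/
theorem jacKStep_holds : JacKStep F := by
  intro a ha
  have hL2 : (2 : ℝ) ≤ F.L := by exact_mod_cast F.hL.2
  have hL1 : (1 : ℝ) ≤ F.L := by linarith
  have hL0 : (0 : ℝ) < F.L := by linarith
  set ℓ : ℝ := (((4 + 2) * F.L : ℕ) : ℝ) with hℓ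
  have hℓ1 : (1 : ℝ) ≤ ℓ := by rw [hℓ]; exact_mod_cast (show 1 ≤ (4 + 2) * F.L by have := F.hL.2; omega)
  have hℓ2 : (1 : ℝ) ≤ ℓ ^ 2 := by nlinarith
  set α : ℝ := min (1 / (51200 * ℓ ^ 2)) (a / (960 * ℓ ^ 2)) with hαdef
  have hαpos : 0 < α := lt_min (by positivity) (by positivity)
  have hα1 : α ≤ 1 / (51200 * ℓ ^ 2) := min_le_left _ _
  have hαa : α ≤ a / (960 * ℓ ^ 2) := min_le_right _ _
  have hαle1 : α ≤ 1 := hα1.trans (by rw [div_le_one (by positivity)]; nlinarith)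
  refine ⟨F.L, fun Mc hMth hMcG => ⟨α, α, hαpos, hαpos, fun k n c φ hφ => ?_⟩⟩
  obtain ⟨u, hu, hdet, hT⟩ := exists_gauge_towerSmallField_of_mem_recordUc F hMcG c hφ
  refine ⟨u, hu, hdet, fun j hj c' hc' i => ?_⟩
  -- the level room `k + 2 ≤ m + K` from `Mc ≥ L`
  have hlog : 1 ≤ Nat.log F.L Mc := by
    obtain ⟨e, rfl⟩ := hMcG
    have he : e ≠ 0 := by
      rintro rfl
      have : F.L ≤ 1 := by simpa using hMth
      have := F.hL.2; omega
    rw [Nat.log_pow (show 1 < F.L by have := F.hL.2; omega)]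
    omega
  have hk2 : k + 2 ≤ (F.P (recordK₀ F Mc k + n)).m + (F.P (recordK₀ F Mc k + n)).K := by
    rw [F.P_K]; unfold recordK₀; omega
  -- the scaled radius
  set ξ : ℝ := (F.P (recordK₀ F Mc k + n)).eta (k + 1) with hξ
  have hξdef : ξ = ((F.L : ℝ)⁻¹) ^ (k + 1) := by rw [hξ, Params.eta]; rfl
  have hξ0 : 0 ≤ ξ := by rw [hξdef]; positivity
  have hξ1 : ξ ≤ 1 := by rw [hξdef]; exact pow_le_one₀ (by positivity) (inv_le_one_of_one_le₀ hL1)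
  have hLξ : (F.L : ℝ) ^ (k + 1) * ξ = 1 := by rw [hξdef, ← mul_pow, mul_inv_cancel₀ hL0.ne', one_pow]
  have hLkξ : (F.L : ℝ) ^ k * ξ = (F.L : ℝ)⁻¹ := by
    rw [hξdef, pow_succ, ← mul_assoc, ← mul_pow, mul_inv_cancel₀ hL0.ne', one_pow, one_mul]
  have hξα : ξ * α ≤ 1 := by nlinarith
  -- the reads level `s₀` and `Lᵏ s₀ ≤ 8α`
  set s₀ : ℝ := 2 * (ξ * α) + (((F.P (recordK₀ F Mc k + n)).d - 1 : ℕ) : ℝ) * ((2 * (F.P (recordK₀ F Mc k + n)).L ^ (k + 1) - 1 : ℕ) : ℝ) * (α * ξ ^ 2)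
    with hs₀
  have hd3 : ((((F.P (recordK₀ F Mc k + n)).d - 1 : ℕ) : ℝ)) = 3 := by norm_num [F.P_d]
  have hn2 : (((2 * (F.P (recordK₀ F Mc k + n)).L ^ (k + 1) - 1 : ℕ) : ℝ)) ≤ 2 * (F.L : ℝ) ^ (k + 1) := by
    have h1 : 1 ≤ 2 * F.L ^ (k + 1) := by have := Nat.one_le_pow (k + 1) F.L (by have := F.hL.2; omega); omega
    rw [F.P_L, Nat.cast_sub h1]; push_cast; linarith
  have hs₀le : s₀ ≤ 8 * α * ξ := by
    rw [hs₀, hd3]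
    have : 3 * (((2 * (F.P (recordK₀ F Mc k + n)).L ^ (k + 1) - 1 : ℕ) : ℝ)) * (α * ξ ^ 2) ≤ 3 * (2 * (F.L : ℝ) ^ (k + 1)) * (α * ξ ^ 2) := by
      gcongr
    have e6 : 3 * (2 * (F.L : ℝ) ^ (k + 1)) * (α * ξ ^ 2) = 6 * α * ξ * ((F.L : ℝ) ^ (k + 1) * ξ) := by ring
    rw [e6, hLξ, mul_one] at this
    linarith
  have hs₀0 : 0 ≤ s₀ := by rw [hs₀]; positivity
  have hLks₀ : (F.L : ℝ) ^ k * s₀ ≤ 8 * α := by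
    calc (F.L : ℝ) ^ k * s₀ ≤ (F.L : ℝ) ^ k * (8 * α * ξ) := by gcongr
      _ = 8 * α * ((F.L : ℝ) ^ k * ξ) := by ring
      _ = 8 * α * (F.L : ℝ)⁻¹ := by rw [hLkξ]
      _ ≤ 8 * α * 1 := by gcongr; exact inv_le_one_of_one_le₀ hL1
      _ = 8 * α := mul_one _
  have hℓ' : (((((F.P (recordK₀ F Mc k + n)).d + 2) * (F.P (recordK₀ F Mc k + n)).L : ℕ) : ℝ)) = ℓ := by rw [hℓ, F.P_d, F.P_L]
  -- the budget and the final bound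
  have hbudget : 6400 * ((((F.P (recordK₀ F Mc k + n)).d + 2) * (F.P (recordK₀ F Mc k + n)).L : ℕ) : ℝ) ^ 2 *
      ((F.P (recordK₀ F Mc k + n)).L : ℝ) ^ k * s₀ ≤ 1 := by
    rw [hℓ', F.P_L]
    calc 6400 * ℓ ^ 2 * (F.L : ℝ) ^ k * s₀ = 6400 * ℓ ^ 2 * ((F.L : ℝ) ^ k * s₀) := by ring
      _ ≤ 6400 * ℓ ^ 2 * (8 * α) := by gcongr
      _ ≤ 6400 * ℓ ^ 2 * (8 * (1 / (51200 * ℓ ^ 2))) := by gcongr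
      _ = 1 := by field_simp; ring
  have hfinal : 120 * ((((F.P (recordK₀ F Mc k + n)).d + 2) * (F.P (recordK₀ F Mc k + n)).L : ℕ) : ℝ) ^ 2 *
      ((F.P (recordK₀ F Mc k + n)).L : ℝ) ^ k * s₀ ≤ a := by
    rw [hℓ', F.P_L]
    calc 120 * ℓ ^ 2 * (F.L : ℝ) ^ k * s₀ = 120 * ℓ ^ 2 * ((F.L : ℝ) ^ k * s₀) := by ring
      _ ≤ 120 * ℓ ^ 2 * (8 * α) := by gcongr
      _ ≤ 120 * ℓ ^ 2 * (8 * (a / (960 * ℓ ^ 2))) := by gcongr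
      _ = a := by field_simp; ring
  exact (towerLoopSmall_of_towerSmallField hk2 c hαpos.le hαpos.le hξα _ hT hbudget j hj c' hc' i).trans hfinal

end Record

end Summit.QuantumFields.YangMills.Theorems.BalabanUVNodesPortS1

end
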